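import HarnessLib.Audit.LibrarySuggestionsDenyListCorCM
import Summits.HodgeConjecture.CorCM.HypLiu418.A3Liu418GSInstance
import Literature.NumberTheory.Automorphic.Liu2021.AppendixC.EtaleHeckeDatumOfTranslates
import Literature.NumberTheory.Automorphic.Liu2021.AppendixC.AlbaneseConjugate
import HarnessLib

/-!
# The UNTWISTED §4.2 datum of the GS curve `M⋆`, its OWN étale Hecke datum, and the Albanese conjugation datum (CONSTRUCTED)

Cell `hodgecm-mathlib` (D-0151), fan A; Summits lane `CorCM/HypLiu418/`; namespace `Summit.HodgeConjecture.CorCM.Lines.A3Liu418`.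
Seat A-p13 (g18), 2026-08-30, director s201 (3)(i)–(ii) (the untwisted datum on which [Liu2021, Cor. D.9] for the curve is VERBATIM,
and the scheme-level input of the K2 transport).  DEFINITIONS WITH BODIES and THEOREMS; no named fact, no instance, no `sorry`.
HC_CM is proved only modulo the 7 printed citations until rung 0 closes; nothing of [Liu2021] is asserted here.

* §1 the UNTWISTED §4.2 datum of the GS curve record `S`: `honestP5GSM` ∕ `honestSystemGSM` ∕ `compactifiedOfGSM` ∕
  **`sec42DataGSM S h4 iso`** (= ★ `A3Liu418GSInstance` §1 with `S.M` in place of `conjSystemGS … S.M = S.M ⋙ baseChangeHom c`;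
  `(sec42DataGSM S h4 iso).X K = S.M.obj K` by `rfl`); same group `U(J⋆)(𝔸_{F⁺,f})`, same threshold `K₀`, same level index as ★ `sec42DataGS`.
* §1′ `M⋆`'s OWN Hecke translates `heckeTranslatesGSM` ∕ `sec42HeckeTranslatesGSM` (the record's chosen translates themselves; (K1)
  `sec42HeckeTranslatesGS_tr_eq_map_GSM`: the twist's are their base changes, `rfl`), `albTransitionEpi_GSM`, `hI_GSM`, `levelQuotientUP_GSM`,
  `isogenyDescent_GSM`, and the HONEST étale Hecke datum **`etaleHeckeDatumGSM S hU7ₛ hLQ h4 iso ℓ`** (★ `etaleHeckeDatumOfTranslates` on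
  `M⋆`'s own translates; hypotheses {u1, u4}; nothing read through `X⋆`).
* §2 `AlbConjDatum S h4 iso` — isomorphisms `e_K : (Alb M⋆_K)^c ≅ Alb X⋆_K` (`AbelianVariety.conjugate` by `c`) NATURAL in every
  `F`-morphism `u : M⋆_K ⟶ M⋆_{K'}` (`e_map`); instances `e_Atr` (transitions), `e_albTr` (Hecke translates); and **`albConjDatum`**, the
  datum CONSTRUCTED from ★ `Liu2021/AppendixC/AlbaneseConjugate` («the Albanese of the twist IS the twist of the Albanese»:
  `Albanese.conjugate`, `Albanese.conjugate_map`, `Albanese.isoOfEq`).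

Sequel: `A3Liu418GSConjugateTransport` (the K2 transport `H¹_ét(X⋆-tower) ≃ H¹_ét(M⋆-tower)` built from `albConjDatum`).
References: [Liu2021] §2.1 Def. 2.3, §4.2 (FJcycle.tex l. 2053–2081), proof of Thm. 4.15 (l. 2193–2208), App. C Prop. C.5, Def. C.8;
[Deligne1979ShimuraVarieties] 2.7.1; [Milne2005ShimuraVarieties] Thm. 13.6, Rem. 5.29 (c); [Deligne1982] §1.
-/

set_option autoImplicit false

noncomputable section

namespace Summit.HodgeConjecture.CorCM.Lines.A3Liu418

open CategoryTheory CategoryTheory.Limits AlgebraicGeometry NumberField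
open scoped TensorProduct NumberField
open Literature.AlgebraicGeometry.Motives
open Literature.AlgebraicGeometry.ShimuraVarieties.UnitaryCanonicalModel
open Literature.NumberTheory.Automorphic Literature.NumberTheory.Automorphic.UnitaryGroup
open Literature.NumberTheory.Automorphic.Liu2021 Literature.NumberTheory.Automorphic.Liu2021.AppendixC
open Literature.NumberTheory.GaloisRepresentations
open Summit.HodgeConjecture.CorCM.Model Summit.HodgeConjecture.CorCM.Model.HComp

variable {F : CMField} {ι₁ : F →+* ℂ} (Jstar : Matrix (Fin 2) (Fin 2) F)
  (K₀ : C5.OpenCompactSubgroup ↥(finAdelic (↥(maximalRealSubfield F)) F (IsCMField.complexConj F) 2 Jstar))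
  (M : C5.SmallLevel K₀ ⥤ SchemeOver F)
/-! ## §1. The UNTWISTED §4.2 datum of the curve `M⋆` -/

/-- The honest Prop-C.5 datum of the curve `U(J⋆)` with the UNTWISTED tower: `Sh τ τ' := K ↦ M_{K ⊓ K₀} ⊗_{F,τ'} τ'(F)`
(★ `honestP5GS` with `M` for `conjSystemGS … M`). [cite: Liu2021, App. C Prop. C.5] -/
abbrev honestP5GSM : PropC5Data (↥(maximalRealSubfield F)) F where
  n := 2
  one_le_n := by norm_num
  𝕍 := Fin 2 → IsDedekindDomain.FiniteAdeleRing (𝓞 F) F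
  G := ↥(finAdelic (↥(maximalRealSubfield F)) F (IsCMField.complexConj F) 2 Jstar)
  V := fun _ => Fin 2 → F
  Gτ := fun _ => ↥(finAdelic (↥(maximalRealSubfield F)) F (IsCMField.complexConj F) 2 Jstar)
  fix := fun _ => ContinuousMulEquiv.refl _
  Sh := fun _ τ' => restrictFunctor K₀ ⋙ M ⋙ C5.baseChangeAlong τ'.rangeRestrictField

/-- Prop. C.5 CONSTRUCTED on `honestP5GSM` (★ `honestSystemGS`, verbatim body with `M`). [cite: Liu2021, App. C Prop. C.5] -/
abbrev honestSystemGSM : IncoherentShimuraSystem (honestP5GSM Jstar K₀ M) where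
  K₀ := K₀
  Sh𝕍 := M
  iso _ τ' _ :=
    (Functor.leftUnitor (M ⋙ C5.baseChangeAlong τ'.rangeRestrictField)).symm ≪≫
      Functor.isoWhiskerRight (transportRestrictIso K₀).symm (M ⋙ C5.baseChangeAlong τ'.rangeRestrictField) ≪≫
      Functor.associator _ _ _

variable {Jstar K₀} (S : RecordSystemGS F Jstar ι₁ K₀)

/-- `M⋆_K` is smooth of relative dimension `1`. [cite: Liu2021, App. C Prop. C.5] -/
theorem smooth_honestSystemGSM_Sh (K : C5.SmallLevel (honestSystemGSM Jstar K₀ S.M).K₀) :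
    SmoothOfRelativeDimension ((honestP5GSM Jstar K₀ S.M).n - 1) ((honestSystemGSM Jstar K₀ S.M).Sh𝕍.obj K).hom :=
  S.smooth K

/-- `M⋆_K` is projective. [cite: Liu2021, App. C Prop. C.5] -/
theorem projective_honestSystemGSM_Sh (K : C5.SmallLevel (honestSystemGSM Jstar K₀ S.M).K₀) :
    IsProjectiveOver ((honestSystemGSM Jstar K₀ S.M).Sh𝕍.obj K) :=
  S.projective K

/-- Def. C.8 in the Compact Case for the untwisted tower: `X := M⋆`, identity comparison maps. [cite: Liu2021, App. C Def. C.8] -/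
def compactifiedOfGSM : CompactifiedSystem (honestSystemGSM Jstar K₀ S.M) :=
  CompactifiedSystem.ofProjective (honestSystemGSM Jstar K₀ S.M) (smooth_honestSystemGSM_Sh S) (projective_honestSystemGSM_Sh S)

/-- The projectivity clause of `Sec42Data` at `n = 2` for the untwisted tower. [cite: Liu2021, §4.2] -/
theorem isProjectiveOver_honestSystemGSM_Sh_iff (h4 : 4 ≤ Module.finrank ℚ F) (iso : ℕ → Prop)
    (K : C5.SmallLevel (honestSystemGSM Jstar K₀ S.M).K₀) :
    IsProjectiveOver ((honestSystemGSM Jstar K₀ S.M).Sh𝕍.obj K) ↔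
      ¬ (Module.finrank ℚ (maximalRealSubfield F) = 1 ∧
        (3 ≤ (honestP5GSM Jstar K₀ S.M).n ∨ ((honestP5GSM Jstar K₀ S.M).n = 2 ∧ ∀ p : ℕ, p.Prime → iso p))) :=
  ⟨fun _ hh => finrank_maximalRealSubfield_ne_one h4 hh.1, fun _ => projective_honestSystemGSM_Sh S K⟩

/-- **Liu's §4.2 datum of the UNTWISTED curve tower `M⋆`** (★ `Sec42Data.ofAlbanese`, Albanese data chosen by
★ `Albanese.nonempty_of_numberField`) — the datum on which [Liu2021, Cor. D.9] for the curve is verbatim.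
[cite: Liu2021, §4.2 and App. C Def. C.8] -/
def sec42DataGSM (h4 : 4 ≤ Module.finrank ℚ F) (iso : ℕ → Prop) : Sec42Data (honestP5GSM Jstar K₀ S.M) iso :=
  Sec42Data.ofAlbanese (Nat.le_of_ble_eq_true rfl) (honestSystemGSM Jstar K₀ S.M)
    (isProjectiveOver_honestSystemGSM_Sh_iff S h4 iso) (compactifiedOfGSM S) fun K =>
      haveI := (compactifiedOfGSM S).smooth_X K
      Classical.choice
        (Albanese.nonempty_of_numberField (d := (honestP5GSM Jstar K₀ S.M).n - 1) ((compactifiedOfGSM S).X.obj K)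
          ((compactifiedOfGSM S).projective_X K))

/-- Its `X_K` is `M⋆_K` on the nose. [cite: Liu2021, §4.2] -/
theorem sec42DataGSM_X (h4 : 4 ≤ Module.finrank ℚ F) (iso : ℕ → Prop) (K : C5.SmallLevel K₀) :
    (sec42DataGSM S h4 iso).X K = S.M.obj K := rfl

/-! ## §1′. `M⋆`'s OWN Hecke translates and its étale Hecke datum (honest: nothing is read through the twist) -/

section HonestHeckeM

/-- **Hecke translates on `honestSystemGSM`**: the record's chosen translates THEMSELVES (`recordHeckeTranslateGS`, which live on
`S.M`; ★ `heckeTranslatesGS` is their base change along `c`); the three laws by the GS-2b uniqueness lemmas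
(`heckeTranslate_eq_map_of_le`, `heckeTranslate_unique`, `isHeckeTranslate_comp`, `heckeTranslate_eq_id_of_mem`) without any functor.
[cite: Milne2005ShimuraVarieties, Thm. 13.6 p. 118] [cite: Liu2021, §4.2] -/
def heckeTranslatesGSM (hU7ₛ : S.HeckeTranslateDefinedOver) :
    IncoherentShimuraSystem.HeckeTranslates (honestSystemGSM Jstar K₀ S.M) where
  tr g K K' hK := recordHeckeTranslateGS S hU7ₛ g K K' hK
  tr_one := fun {K K'} f =>
    S.heckeTranslate_eq_map_of_le f (isHeckeTranslate_recordHeckeTranslateGS S hU7ₛ 1 K K' _)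
  tr_mul := fun g g' {K K' K''} hK hK' =>
    S.heckeTranslate_unique
      (S.isHeckeTranslate_comp (isHeckeTranslate_recordHeckeTranslateGS S hU7ₛ g K K' hK)
        (isHeckeTranslate_recordHeckeTranslateGS S hU7ₛ g' K' K'' hK'))
      (isHeckeTranslate_recordHeckeTranslateGS S hU7ₛ (g * g') K K'' (hK.mul hK'))
  tr_self := fun {K k} hk =>
    S.heckeTranslate_eq_id_of_mem hk (isHeckeTranslate_recordHeckeTranslateGS S hU7ₛ k K K _)

/-- The same on the §4.2 datum `sec42DataGSM` (Compact Case packaging ★ `.ofProjective`). [cite: Liu2021, §4.2 and App. C Def. C.8] -/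
def sec42HeckeTranslatesGSM (hU7ₛ : S.HeckeTranslateDefinedOver) (h4 : 4 ≤ Module.finrank ℚ F) (iso : ℕ → Prop) :
    (sec42DataGSM S h4 iso).HeckeTranslates :=
  (heckeTranslatesGSM S hU7ₛ).ofProjective (Nat.le_of_ble_eq_true rfl) (isProjectiveOver_honestSystemGSM_Sh_iff S h4 iso)
    (smooth_honestSystemGSM_Sh S) (projective_honestSystemGSM_Sh S) _

/-- Its translate IS the chosen record translate (`rfl`). [cite: Liu2021, §4.2] -/
theorem sec42HeckeTranslatesGSM_tr (hU7ₛ : S.HeckeTranslateDefinedOver) (h4 : 4 ≤ Module.finrank ℚ F) (iso : ℕ → Prop)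
    (g : ↥(finAdelic (↥(maximalRealSubfield F)) F (IsCMField.complexConj F) 2 Jstar)) (K K' : C5.SmallLevel K₀)
    (hK : C5.HeckeLE g K K') :
    (sec42HeckeTranslatesGSM S hU7ₛ h4 iso).tr g K K' hK = recordHeckeTranslateGS S hU7ₛ g K K' hK := rfl

/-- **(K1) the twist's translates are the base changes along `c` of `M⋆`'s, for the SAME `g`** (`rfl`).
[cite: Liu2021, §4.2 and proof of Thm. 4.15 (FJcycle.tex l. 2193–2208)] -/
theorem sec42HeckeTranslatesGS_tr_eq_map_GSM (hU7ₛ : S.HeckeTranslateDefinedOver) (h4 : 4 ≤ Module.finrank ℚ F)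
    (iso : ℕ → Prop) (g : ↥(finAdelic (↥(maximalRealSubfield F)) F (IsCMField.complexConj F) 2 Jstar)) (K K' : C5.SmallLevel K₀)
    (hK : C5.HeckeLE g K K') :
    (sec42HeckeTranslatesGS S hU7ₛ h4 iso).tr g K K' hK =
      (baseChangeHom (cmConjRingHom F)).map ((sec42HeckeTranslatesGSM S hU7ₛ h4 iso).tr g K K' hK) := rfl

/-- **(I) for the UNTWISTED curve tower**: every `Alb_{u^{K'}_K} = (sec42DataGSM S h4 iso).Atr f` is an epimorphism —
★ `Sec42Data.epi_Atr_of_pieces_lift` fed DIRECTLY with ★ `RecordSystemGS.pieces_pair_lift` (no comparison isomorphism: the complex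
fibre is `M_K ⊗_{ι₁} ℂ` itself). [cite: Liu2021, §4.2 (surjectivity of the Albanese transitions) and proof of Thm. 4.15]
[cite: Deligne1979ShimuraVarieties, 2.7.1 (c)] -/
theorem albTransitionEpi_GSM (h4 : 4 ≤ Module.finrank ℚ F) (iso : ℕ → Prop) ⦃K K' : C5.SmallLevel K₀⦄ (f : K' ⟶ K) :
    Epi ((sec42DataGSM S h4 iso).Atr f) := by
  letI : Algebra (F : Type) ℂ := ι₁.toAlgebra
  obtain ⟨κ, κ', P, P', inj, hP, hcol, inj', hP', hl⟩ := S.pieces_pair_lift f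
  haveI := hP
  haveI := hP'
  exact (sec42DataGSM S h4 iso).epi_Atr_of_pieces_lift f inj hcol inj' hl

/-- **The `hI` binder of ★ `etaleHeckeDatumOfTranslates` for the untwisted curve tower**: the dual of `V_ℓ(Alb_{u^{K'}_K})` is
injective (★ `AbelianVariety.injective_dualMap_rationalTateModuleMap_of_epi` ∘ `albTransitionEpi_GSM`).
[cite: Liu2021, §4.2 and App. C (the étale `H¹` of the Albanese tower)] -/
theorem hI_GSM (h4 : 4 ≤ Module.finrank ℚ F) (iso : ℕ → Prop) (ℓ : ℕ) [Fact ℓ.Prime] ⦃K K' : C5.SmallLevel K₀⦄ (f : K' ⟶ K) :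
    Function.Injective (AbelianVariety.rationalTateModuleMap ℓ ((sec42DataGSM S h4 iso).Atr f)).dualMap :=
  haveI := albTransitionEpi_GSM S h4 iso f
  AbelianVariety.injective_dualMap_rationalTateModuleMap_of_epi ℓ _

/-- **`u^N_K : M⋆_N ⟶ M⋆_K` is the quotient of `M⋆_N` by the translates `T_k`, `k ∈ K`, for separated test objects**, granted u4 —
the record level of ★ `levelQuotientUP_GS` ALONE (every translate is THE chosen one by ★ `heckeTranslate_unique`), no base change.
[cite: Deligne1979ShimuraVarieties, 2.7.1 (b)–(c)] [cite: Milne2005ShimuraVarieties, Rem. 5.29 (c) p. 65] -/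
theorem levelQuotientUP_GSM (hU7ₛ : S.HeckeTranslateDefinedOver) (hLQ : S.IsLevelQuotient) (h4 : 4 ≤ Module.finrank ℚ F)
    (isoₛ : ℕ → Prop) ⦃N K : C5.SmallLevel K₀⦄ (hNK : N ≤ K) (hn : ∀ k ∈ K.1.1, C5.HeckeLE k N N)
    (W : SchemeOver F) (f : (sec42DataGSM S h4 isoₛ).X N ⟶ W) (hW : IsSeparated W.hom)
    (hf : ∀ (k : ↥(finAdelic (↥(maximalRealSubfield F)) F (IsCMField.complexConj F) 2 Jstar)) (hk : k ∈ K.1.1),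
      (sec42HeckeTranslatesGSM S hU7ₛ h4 isoₛ).tr k N N (hn k hk) ≫ f = f) :
    ∃! fbar : (sec42DataGSM S h4 isoₛ).X K ⟶ W, (sec42DataGSM S h4 isoₛ).cpt.X.map (homOfLE hNK) ≫ fbar = f := by
  obtain ⟨act, hact, hsep⟩ := hLQ hNK (fun k hk n hn' => hn k hk n hn')
  refine hsep.2 W f hW fun k => ?_
  have hk' : ((k : ↥(finAdelic (↥(maximalRealSubfield F)) F (IsCMField.complexConj F) 2 Jstar))⁻¹) ∈ K.1.1 :=
    K.1.1.inv_mem k.2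
  rw [S.heckeTranslate_unique (hact k)
    (isHeckeTranslate_recordHeckeTranslateGS S hU7ₛ
      ((k : ↥(finAdelic (↥(maximalRealSubfield F)) F (IsCMField.complexConj F) 2 Jstar))⁻¹) N N (hn _ hk'))]
  exact hf _ hk'

/-- **(D) `IsogenyDescent` for the untwisted curve tower, from u4 ALONE** (★ `isogenyDescent_of_levelQuotient_holds`).
[cite: Liu2021, App. C (isogeny descent along the tower)] [cite: Deligne1979ShimuraVarieties, 2.7.1 (c)] -/
theorem isogenyDescent_GSM (hU7ₛ : S.HeckeTranslateDefinedOver) (hLQ : S.IsLevelQuotient) (h4 : 4 ≤ Module.finrank ℚ F)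
    (isoₛ : ℕ → Prop) : (sec42HeckeTranslatesGSM S hU7ₛ h4 isoₛ).IsogenyDescent :=
  (sec42HeckeTranslatesGSM S hU7ₛ h4 isoₛ).isogenyDescent_of_levelQuotient_holds (levelQuotientUP_GSM S hU7ₛ hLQ h4 isoₛ)

/-- **The étale Hecke datum of the UNTWISTED curve tower induced by ITS OWN translates** — ★ `etaleHeckeDatumOfTranslates` at
`hI := hI_GSM` and `hD := isogenyDescent_GSM`; hypotheses exactly {u1 `hU7ₛ`, u4 `hLQ`}; nothing transported through `X⋆`.
[cite: Liu2021, §4.2 and App. C (the étale `H¹` of the Albanese tower with its Hecke action)] -/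
def etaleHeckeDatumGSM (hU7ₛ : S.HeckeTranslateDefinedOver) (hLQ : S.IsLevelQuotient) (h4 : 4 ≤ Module.finrank ℚ F)
    (isoₛ : ℕ → Prop) (ℓ : ℕ) [Fact ℓ.Prime] : (sec42DataGSM S h4 isoₛ).EtaleHeckeDatum ℓ :=
  (sec42HeckeTranslatesGSM S hU7ₛ h4 isoₛ).etaleHeckeDatumOfTranslates ℓ (hI_GSM S h4 isoₛ ℓ)
    (isogenyDescent_GSM S hU7ₛ hLQ h4 isoₛ)

/-- It IS induced by `M⋆`'s translates (★ `isInducedBy_etaleHeckeDatumOfTranslates`). [cite: Liu2021, §4.2 and App. C] -/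
theorem isInducedBy_etaleHeckeDatumGSM (hU7ₛ : S.HeckeTranslateDefinedOver) (hLQ : S.IsLevelQuotient)
    (h4 : 4 ≤ Module.finrank ℚ F) (isoₛ : ℕ → Prop) (ℓ : ℕ) [Fact ℓ.Prime] :
    (etaleHeckeDatumGSM S hU7ₛ hLQ h4 isoₛ ℓ).IsInducedBy (sec42HeckeTranslatesGSM S hU7ₛ h4 isoₛ) :=
  (sec42HeckeTranslatesGSM S hU7ₛ h4 isoₛ).isInducedBy_etaleHeckeDatumOfTranslates ℓ (hI_GSM S h4 isoₛ ℓ)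
    (isogenyDescent_GSM S hU7ₛ hLQ h4 isoₛ)

/-- Its Hecke action is ★ `etHeckeRep` of `M⋆`'s translates (`rfl`). [cite: Liu2021, §4.2 (FJcycle.tex l. 2160)] -/
theorem rhoEt_etaleHeckeDatumGSM (hU7ₛ : S.HeckeTranslateDefinedOver) (hLQ : S.IsLevelQuotient)
    (h4 : 4 ≤ Module.finrank ℚ F) (isoₛ : ℕ → Prop) (ℓ : ℕ) [Fact ℓ.Prime] :
    (etaleHeckeDatumGSM S hU7ₛ hLQ h4 isoₛ ℓ).rhoEt = (sec42HeckeTranslatesGSM S hU7ₛ h4 isoₛ).etHeckeRep ℓ := rfl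

end HonestHeckeM
/-! ## §2. The Albanese conjugation datum (the ONE scheme-level input, as a hypothesis structure) -/

/-- Complex conjugation of the CM field as a ring automorphism (`(cγ F).toRingHom = cmConjRingHom F` by `rfl`, so the twist
`X_K = (baseChangeHom (cmConjRingHom F)).obj M_K` IS `conjugateVariety (cγ F) M_K`). [cite: Deligne1982, §1] -/
abbrev cγ (F : CMField) : (F : Type) ≃+* (F : Type) := (IsCMField.complexConj (F : Type)).toRingEquiv

/-- `X⋆_K = (M⋆_K)^c` as schemes over `F` (`rfl`). [cite: Deligne1982, §1] [cite: Liu2021, §4.2] -/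
theorem sec42DataGS_X_eq_conjugateVariety (h4 : 4 ≤ Module.finrank ℚ F) (iso : ℕ → Prop) (K : C5.SmallLevel K₀) :
    (sec42DataGS S h4 iso).X K = conjugateVariety (cγ F) ((sec42DataGSM S h4 iso).X K) := rfl

/-- **The Albanese conjugation datum** for the pair (twisted datum `sec42DataGS S`, untwisted datum `sec42DataGSM S`):
isomorphisms `e_K : (Alb M⋆_K)^c ≅ Alb X⋆_K` of abelian varieties over `F` (the conjugate `AbelianVariety.conjugate (cγ F)`),
compatible with the Albanese transition maps of the two towers («`Alb_u` of the twist is the twist of `Alb_u`»).  A hypothesis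
STRUCTURE (the universal property of `Alb` commutes with base change along `Spec c`; CONSTRUCTED in §6 `albConjDatum`);
nothing asserted. [cite: Liu2021, §4.2 l. 2066–2072 and Def. 2.3] [cite: Deligne1982, §1] -/
structure AlbConjDatum (h4 : 4 ≤ Module.finrank ℚ F) (iso : ℕ → Prop) : Type 1 where
  /-- ⟨CARRIER⟩ `e_K : (Alb M⋆_K)^c ≅ Alb X⋆_K`. -/
  e : ∀ K : C5.SmallLevel K₀,
    ((sec42DataGSM S h4 iso).A K).conjugate (cγ F) ≅ (sec42DataGS S h4 iso).A K
  /-- NATURALITY in every `F`-morphism `u : M⋆_K ⟶ M⋆_{K'}` of levels of the tower: `(Alb^{M}(u))^c ≫ e_{K'} = e_K ≫ Alb^{X}(u ⊗_c F)`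
  (`Albanese.map` of the two chosen Albanese data; the twist's morphism is the base change of `u`). Both the transition squares
  (`u := u^{K'}_K`) and the Hecke-translate squares (`u := T_g`) are instances. -/
  e_map : ∀ {K K' : C5.SmallLevel K₀} (u : S.M.obj K ⟶ S.M.obj K'),
    AbelianVariety.Hom.conjugate (cγ F) (((sec42DataGSM S h4 iso).alb K).map ((sec42DataGSM S h4 iso).alb K') u) ≫ (e K').hom =
      (e K).hom ≫ ((sec42DataGS S h4 iso).alb K).map ((sec42DataGS S h4 iso).alb K') ((baseChangeHom (cmConjRingHom F)).map u)

namespace AlbConjDatum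

variable {S} {h4 : 4 ≤ Module.finrank ℚ F} {iso : ℕ → Prop} (D : AlbConjDatum S h4 iso)

/-- **Compatibility with the Albanese transitions**: `(Alb^{M}_u)^c ≫ e_K = e_{K'} ≫ Alb^{X}_u` for `u : K' ⟶ K` (the instance
`u := u^{K'}_K` of `e_map`; `Atr f = Albanese.map (u f)` and `u^{X} = u^{M} ⊗_c F` by `rfl`). [cite: Liu2021, §4.2 l. 2066–2072 and Def. 2.3] -/
theorem e_Atr {K K' : C5.SmallLevel K₀} (f : K' ⟶ K) :
    AbelianVariety.Hom.conjugate (cγ F) ((sec42DataGSM S h4 iso).Atr f) ≫ (D.e K).hom =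
      (D.e K').hom ≫ (sec42DataGS S h4 iso).Atr f :=
  D.e_map (S.M.map f)

/-- **Compatibility with the Albanese of the Hecke translates**: `(Alb T^{M}_g)^c ≫ e_{K'} = e_K ≫ Alb T^{X}_g` for `g⁻¹Kg ⊆ K'`
(the instance `u := T_g` of `e_map`; `albTr = Albanese.map T_g` and (K1) `T^{X}_g = T^{M}_g ⊗_c F` by `rfl`).
[cite: Liu2021, §4.2 l. 2074 and Def. 2.3] -/
theorem e_albTr (hU7ₛ : S.HeckeTranslateDefinedOver)
    (g : ↥(finAdelic (↥(maximalRealSubfield F)) F (IsCMField.complexConj F) 2 Jstar)) (K K' : C5.SmallLevel K₀)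
    (hK : C5.HeckeLE g K K') :
    AbelianVariety.Hom.conjugate (cγ F) ((sec42HeckeTranslatesGSM S hU7ₛ h4 iso).albTr g K K' hK) ≫ (D.e K').hom =
      (D.e K).hom ≫ (sec42HeckeTranslatesGS S hU7ₛ h4 iso).albTr g K K' hK :=
  D.e_map (recordHeckeTranslateGS S hU7ₛ g K K' hK)

end AlbConjDatum

/-! ### §2′. The datum CONSTRUCTED (★ `Liu2021/AppendixC/AlbaneseConjugate`) -/

section Construct

variable {S}

set_option maxHeartbeats 1600000 in
/-- **The Albanese conjugation datum of the GS curve tower, CONSTRUCTED**: `e_K := Alb_{𝟙}` between the conjugate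
`(Alb M⋆_K)^c` of the chosen Albanese datum of `M⋆_K` — an Albanese datum of `(M⋆_K)^c = X⋆_K` by `Albanese.conjugate` — and the
chosen Albanese datum of `X⋆_K` (`Albanese.isoOfEq`); naturality in every `u : M⋆_K ⟶ M⋆_{K'}` by `(Alb_u)^c = Alb_{u^c}`
(`Albanese.conjugate_map`) and functoriality (`Albanese.map_comp_isoOfEq_hom`).  Nothing posited.
[cite: Liu2021, §2.1 Def. 2.3 (l. 1202–1208) and §4.2 (l. 2066–2072)] [cite: Deligne1982, §1] -/
def albConjDatum (h4 : 4 ≤ Module.finrank ℚ F) (iso : ℕ → Prop) : AlbConjDatum S h4 iso where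
  e K := Albanese.isoOfEq (((sec42DataGSM S h4 iso).alb K).conjugate (cγ F)) ((sec42DataGS S h4 iso).alb K)
  e_map u := by
    rw [Albanese.conjugate_map]
    exact Albanese.map_comp_isoOfEq_hom _ _ _ _ _

/-- The datum type is inhabited. [cite: Liu2021, §2.1 Def. 2.3] -/
theorem nonempty_albConjDatum (h4 : 4 ≤ Module.finrank ℚ F) (iso : ℕ → Prop) : Nonempty (AlbConjDatum S h4 iso) :=
  ⟨albConjDatum (S := S) h4 iso⟩

end Construct

end Summit.HodgeConjecture.CorCM.Lines.A3Liu418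

end
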